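import Mathlib.Analysis.Complex.Hadamard
import Mathlib.Analysis.SpecialFunctions.Complex.Log
import Mathlib.Analysis.SpecialFunctions.Trigonometric.Arctan
import Mathlib.Analysis.Complex.ReImTopology

/-!
# The two-constants theorem on the disc, diameter versus circle (Nevanlinna–Ostrowski), from Hadamard's three lines

Topic `Literature/Analysis/Complex`.  The special case of the *n*-constants theorem of F. and R. Nevanlinna and A. Ostrowski
(1922) — [Hille, *Analytic Function Theory* II, Thm. 18.3.2 ∕ 18.3.3; Ransford, *Potential Theory in the Complex Plane*,
Thm. 4.3.7 (`Literature.Analysis.Potential.TwoConstantTheorem`)] — that is used to pass a SMALLNESS known on the REAL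
diameter of a disc of analyticity to the interior of the disc, with an explicit exponent: if `f` is holomorphic in the open
unit disc and continuous on the closed disc, `‖f‖ ≤ M` on the closed disc and `‖f(x)‖ ≤ m` for real `x ∈ (−1, 1)`, then
`‖f(z)‖ ≤ m^{1−τ(z)} · M^{τ(z)}` with `τ(z) = (2/π)·arctan(2|Im z| ∕ (1 − |z|²))` (`= 1 −` the harmonic measure of the
diameter in the half-disc containing `z`; `τ(iy) = (4/π)·arctan y`).  PROVED here (no named fact) for functions with
values in a complex Banach space, by transporting Mathlib's Hadamard three-lines theorem
(`Complex.HadamardThreeLines.norm_le_interp_of_mem_verticalClosedStrip₀₁'`) along the conformal map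
`ζ ↦ (e^{iπζ/2} − 1)/(e^{iπζ/2} + 1)` of the strip `0 ≤ Re ζ ≤ 1` onto the closed upper half-disc (the line `Re ζ = 0` onto
the diameter, `Re ζ = 1` onto the upper semicircle).  Uniform corollary on `|z| ≤ r < 1`: exponent
`λ(r) = (2/π)·arctan(2r/(1 − r²)) < 1` (`norm_le_two_constants_disc_of_norm_le`).

Consumer (cell `pub-balaban`, T⁴ continuum programme, row NE5, owner ruling R49 (4)): a two-spacing RATE known for REAL
background fields passes to the COMPLEX small-field chart on which Bałaban's renormalisation step reads the earlier
terms ([Balaban1988RG2Cluster] (1.33)–(1.34)), at the cost of the exponent `1 − λ(r)`, given only the printed analyticity and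
uniform bounds of the operators in the background ([Balaban1988RG2Cluster] (1.5), p. 6 «all the bounds above are uniform on
the domain»).  Nothing of that application is in this file.
-/

noncomputable section

open Complex Set Metric Filter Topology Real

namespace Literature.Analysis.Complex.TwoConstantsDisc

/-- The exponent of the two-constants estimate at `z` in the unit disc: `τ(z) = (2/π)·arctan(2|Im z| ∕ (1 − ‖z‖²))`
(`= (2/π)·|arg((1+z)/(1−z))|`, one minus the harmonic measure of the diameter in the half-disc through `z`). [folklore] -/
def tau (z : ℂ) : ℝ := 2 / π * Real.arctan (2 * |z.im| / (1 - ‖z‖ ^ 2))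

/-- [folklore] `0 ≤ τ(z)` on the open disc. -/
private theorem tau_nonneg {z : ℂ} (hz : ‖z‖ < 1) : 0 ≤ tau z := by
  unfold tau
  have h1 : 0 ≤ 1 - ‖z‖ ^ 2 := by nlinarith [norm_nonneg z]
  have : 0 ≤ Real.arctan (2 * |z.im| / (1 - ‖z‖ ^ 2)) := by
    rw [← Real.arctan_zero]
    exact Real.arctan_strictMono.monotone (div_nonneg (by positivity) h1)
  positivity

/-- [folklore] `τ(z) < 1` on the open disc. -/
private theorem tau_lt_one (z : ℂ) : tau z < 1 := by
  unfold tau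
  have h := Real.arctan_lt_pi_div_two (2 * |z.im| / (1 - ‖z‖ ^ 2))
  have hπ : 0 < π := Real.pi_pos
  rw [div_mul_eq_mul_div, div_lt_one hπ]
  linarith

/-- [folklore] Monotonicity of the exponent in the distance to the centre: `τ(z) ≤ (2/π)·arctan(2r/(1−r²))` for `‖z‖ ≤ r < 1`. -/
private theorem tau_le_of_norm_le {z : ℂ} {r : ℝ} (hz : ‖z‖ ≤ r) (hr : r < 1) :
    tau z ≤ 2 / π * Real.arctan (2 * r / (1 - r ^ 2)) := by
  unfold tau
  have hr0 : 0 ≤ r := (norm_nonneg z).trans hz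
  have h1 : 0 < 1 - r ^ 2 := by nlinarith
  have h2 : 1 - r ^ 2 ≤ 1 - ‖z‖ ^ 2 := by nlinarith [norm_nonneg z]
  have him : |z.im| ≤ r := (abs_im_le_norm z).trans hz
  refine mul_le_mul_of_nonneg_left (Real.arctan_strictMono.monotone ?_) (by positivity)
  calc 2 * |z.im| / (1 - ‖z‖ ^ 2) ≤ 2 * |z.im| / (1 - r ^ 2) :=
        div_le_div_of_nonneg_left (by positivity) h1 h2
    _ ≤ 2 * r / (1 - r ^ 2) := div_le_div_of_nonneg_right (by linarith) h1.le

/-! ## The conformal map of the strip onto the half-disc -/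

/-- The map `ζ ↦ (e^{iπζ/2} − 1)/(e^{iπζ/2} + 1)` (`= tanh(iπζ/4)`): the closed strip `0 ≤ Re ζ ≤ 1` onto the closed upper
half of the unit disc, the imaginary axis onto the diameter `(−1, 1)`. [folklore] -/
def strToDisc (ζ : ℂ) : ℂ := (exp (I * (π / 2) * ζ) - 1) / (exp (I * (π / 2) * ζ) + 1)

/-- [folklore] The real part of `e^{iπζ/2}` is `e^{−π Im ζ/2}·cos(π Re ζ/2)`. -/
private theorem re_exp_rot (ζ : ℂ) : (exp (I * (π / 2) * ζ)).re = Real.exp (-(π / 2 * ζ.im)) * Real.cos (π / 2 * ζ.re) := by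
  rw [Complex.exp_re]
  congr 1
  · congr 1
    simp [mul_re, mul_im]
  · congr 1
    simp [mul_re, mul_im]

/-- [folklore] On the closed strip `0 ≤ Re ζ ≤ 1` the real part of `e^{iπζ/2}` is non-negative. -/
private theorem re_exp_rot_nonneg {ζ : ℂ} (h0 : 0 ≤ ζ.re) (h1 : ζ.re ≤ 1) : 0 ≤ (exp (I * (π / 2) * ζ)).re := by
  rw [re_exp_rot]
  refine mul_nonneg (Real.exp_pos _).le (Real.cos_nonneg_of_mem_Icc ⟨?_, ?_⟩)
  · nlinarith [Real.pi_pos]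
  · nlinarith [Real.pi_pos]

/-- [folklore] On the open strip `0 ≤ Re ζ < 1` the real part of `e^{iπζ/2}` is positive. -/
private theorem re_exp_rot_pos {ζ : ℂ} (h0 : 0 ≤ ζ.re) (h1 : ζ.re < 1) : 0 < (exp (I * (π / 2) * ζ)).re := by
  rw [re_exp_rot]
  refine mul_pos (Real.exp_pos _) (Real.cos_pos_of_mem_Ioo ⟨?_, ?_⟩)
  · nlinarith [Real.pi_pos]
  · nlinarith [Real.pi_pos]

/-- [folklore] `‖a − 1‖² = ‖a‖² − 2 Re a + 1` and `‖a + 1‖² = ‖a‖² + 2 Re a + 1`, as the difference. -/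
private theorem normSq_add_one_sub_normSq_sub_one (a : ℂ) : normSq (a + 1) - normSq (a - 1) = 4 * a.re := by
  simp [normSq_apply]
  ring

/-- [folklore] The denominator does not vanish on the closed strip. -/
private theorem exp_rot_add_one_ne_zero {ζ : ℂ} (h0 : 0 ≤ ζ.re) (h1 : ζ.re ≤ 1) : exp (I * (π / 2) * ζ) + 1 ≠ 0 := by
  intro h
  have hre := congrArg Complex.re h
  simp only [add_re, one_re, zero_re] at hre
  linarith [re_exp_rot_nonneg h0 h1]

/-- [folklore] The map takes the closed strip into the closed unit disc. -/
private theorem norm_strToDisc_le_one {ζ : ℂ} (h0 : 0 ≤ ζ.re) (h1 : ζ.re ≤ 1) : ‖strToDisc ζ‖ ≤ 1 := by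
  unfold strToDisc
  set a := exp (I * (π / 2) * ζ)
  have hden : a + 1 ≠ 0 := exp_rot_add_one_ne_zero h0 h1
  rw [norm_div, div_le_one (norm_pos_iff.2 hden)]
  have hsq : ‖a - 1‖ ^ 2 ≤ ‖a + 1‖ ^ 2 := by
    rw [← Complex.normSq_eq_norm_sq, ← Complex.normSq_eq_norm_sq]
    linarith [normSq_add_one_sub_normSq_sub_one a, re_exp_rot_nonneg h0 h1]
  exact (pow_le_pow_iff_left₀ (norm_nonneg _) (norm_nonneg _) two_ne_zero).1 hsq

/-- [folklore] The map takes the half-open strip `0 ≤ Re ζ < 1` into the open unit disc. -/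
private theorem norm_strToDisc_lt_one {ζ : ℂ} (h0 : 0 ≤ ζ.re) (h1 : ζ.re < 1) : ‖strToDisc ζ‖ < 1 := by
  unfold strToDisc
  set a := exp (I * (π / 2) * ζ)
  have hden : a + 1 ≠ 0 := exp_rot_add_one_ne_zero h0 h1.le
  rw [norm_div, div_lt_one (norm_pos_iff.2 hden)]
  have hsq : ‖a - 1‖ ^ 2 < ‖a + 1‖ ^ 2 := by
    rw [← Complex.normSq_eq_norm_sq, ← Complex.normSq_eq_norm_sq]
    linarith [normSq_add_one_sub_normSq_sub_one a, re_exp_rot_pos h0 h1]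
  exact (pow_lt_pow_iff_left₀ (norm_nonneg _) (norm_nonneg _) two_ne_zero).1 hsq

/-- [folklore] On the imaginary axis the map is REAL with values in `(−1, 1)`. -/
private theorem strToDisc_of_re_eq_zero {ζ : ℂ} (h : ζ.re = 0) :
    ∃ x : ℝ, |x| < 1 ∧ strToDisc ζ = x := by
  have hζ : ζ = (ζ.im : ℂ) * I := by
    apply Complex.ext <;> simp [h]
  set s : ℝ := -(π / 2 * ζ.im) with hs
  have hexp : exp (I * (π / 2) * ζ) = (Real.exp s : ℂ) := by
    rw [hζ, Complex.ofReal_exp]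
    congr 1
    rw [hs]
    push_cast
    ring_nf
    rw [Complex.I_sq]
    ring
  refine ⟨(Real.exp s - 1) / (Real.exp s + 1), ?_, ?_⟩
  · have hp := Real.exp_pos s
    rw [abs_div, abs_of_pos (by linarith : 0 < Real.exp s + 1), div_lt_one (by linarith)]
    exact abs_lt.2 ⟨by linarith, by linarith⟩
  · unfold strToDisc
    rw [hexp]
    push_cast
    rfl

/-- [folklore] The map is differentiable on the closed strip (the denominator never vanishes there). -/
private theorem differentiableAt_strToDisc {ζ : ℂ} (h0 : 0 ≤ ζ.re) (h1 : ζ.re ≤ 1) : DifferentiableAt ℂ strToDisc ζ := by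
  unfold strToDisc
  have he : DifferentiableAt ℂ (fun ζ : ℂ => exp (I * (π / 2) * ζ)) ζ :=
    (Complex.differentiable_exp.comp ((differentiable_id (𝕜 := ℂ)).const_mul (I * (π / 2)))).differentiableAt
  exact (he.sub_const 1).div (he.add_const 1) (exp_rot_add_one_ne_zero h0 h1)

/-- [folklore] The map is continuous on the closed strip. -/
private theorem continuousOn_strToDisc : ContinuousOn strToDisc (re ⁻¹' Icc 0 1) := fun _ hζ =>
  (differentiableAt_strToDisc hζ.1 hζ.2).continuousAt.continuousWithinAt

/-- [folklore] **The map hits every point of the UPPER half-disc from the strip**: for `‖z‖ < 1` with `0 ≤ Im z`, the point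
`ζ₀ = −(2i/π)·log((1+z)/(1−z))` lies in the strip `0 ≤ Re ζ₀ < 1`, maps to `z`, and `Re ζ₀ = τ(z)`. -/
private theorem exists_preimage_strToDisc {z : ℂ} (hz : ‖z‖ < 1) (hzi : 0 ≤ z.im) :
    ∃ ζ : ℂ, 0 ≤ ζ.re ∧ ζ.re < 1 ∧ strToDisc ζ = z ∧ ζ.re = tau z := by
  -- the Cayley image `w = (1+z)/(1−z)` has positive real part
  have h1z : (1 : ℂ) - z ≠ 0 := by
    intro h
    have : ‖z‖ = 1 := by rw [← sub_eq_zero.1 h]; simp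
    linarith
  set w : ℂ := (1 + z) / (1 - z) with hw
  have hnz : 0 < normSq (1 - z) := normSq_pos.2 h1z
  have hnz' : normSq (1 - z) ≠ 0 := hnz.ne'
  have hn : ‖z‖ ^ 2 = z.re ^ 2 + z.im ^ 2 := by rw [Complex.sq_norm, normSq_apply]; ring
  have hwre : w.re = (1 - ‖z‖ ^ 2) / normSq (1 - z) := by
    rw [hn, hw, Complex.div_re]
    have e1 : (1 + z).re = 1 + z.re := by simp
    have e2 : (1 - z).re = 1 - z.re := by simp
    have e3 : (1 + z).im = z.im := by simp
    have e4 : (1 - z).im = -z.im := by simp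
    rw [e1, e2, e3, e4]
    field_simp
    ring
  have hwim : w.im = 2 * z.im / normSq (1 - z) := by
    rw [hw, Complex.div_im]
    have e1 : (1 + z).re = 1 + z.re := by simp
    have e2 : (1 - z).re = 1 - z.re := by simp
    have e3 : (1 + z).im = z.im := by simp
    have e4 : (1 - z).im = -z.im := by simp
    rw [e1, e2, e3, e4]
    field_simp
    ring
  have hz2 : 0 < 1 - ‖z‖ ^ 2 := by nlinarith [norm_nonneg z]
  have hwre_pos : 0 < w.re := by rw [hwre]; positivity
  have hw0 : w ≠ 0 := fun h => by rw [h] at hwre_pos; simp at hwre_pos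
  have hwim_nn : 0 ≤ w.im := by rw [hwim]; positivity
  -- its argument is `arctan (2 Im z / (1 − ‖z‖²)) ∈ [0, π/2)`
  have harg_lt : |arg w| < π / 2 := Complex.abs_arg_lt_pi_div_two_iff.2 (Or.inl hwre_pos)
  have harg : arg w = Real.arctan (2 * z.im / (1 - ‖z‖ ^ 2)) := by
    have ht := Complex.tan_arg w
    have hq : w.im / w.re = 2 * z.im / (1 - ‖z‖ ^ 2) := by
      rw [hwre, hwim]
      field_simp
    rw [← Real.arctan_tan (x := arg w) (by linarith [(abs_lt.1 harg_lt).1]) (abs_lt.1 harg_lt).2, ht, hq]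
  have harg_nn : 0 ≤ arg w := Complex.arg_nonneg_iff.2 hwim_nn
  -- the preimage
  set ζ₀ : ℂ := -(2 / π) * I * log w with hζ₀
  have hζre : ζ₀.re = 2 / π * arg w := by
    rw [hζ₀]
    have : (-(2 / π) * I * log w).re = 2 / π * (log w).im := by
      simp [mul_re, mul_im]
    rw [this, Complex.log_im]
  have hτ : ζ₀.re = tau z := by
    rw [hζre, tau, harg, abs_of_nonneg hzi]
  refine ⟨ζ₀, ?_, ?_, ?_, hτ⟩
  · rw [hζre]; positivity
  · rw [hτ]; exact tau_lt_one z
  · -- `exp (iπ/2 · ζ₀) = exp (log w) = w`, and the Möbius inverse of the Cayley map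
    have hexp : exp (I * (π / 2) * ζ₀) = w := by
      rw [hζ₀]
      have : I * (π / 2) * (-(2 / π) * I * log w) = log w := by
        have hπ : (π : ℂ) ≠ 0 := by exact_mod_cast Real.pi_ne_zero
        field_simp
        ring_nf
        rw [Complex.I_sq]
        ring
      rw [this, Complex.exp_log hw0]
    unfold strToDisc
    rw [hexp, hw]
    field_simp
    ring

/-! ## The theorem -/

variable {E : Type*} [NormedAddCommGroup E] [NormedSpace ℂ E]

/-- **Two-constants theorem, disc ∕ diameter, upper half** (the case `Im z ≥ 0`). [cite: Ransford1995, Thm. 4.3.7] -/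
theorem norm_le_two_constants_disc_of_im_nonneg {f : ℂ → E} {m M : ℝ} (hf : DiffContOnCl ℂ f (ball 0 1))
    (hM : ∀ z : ℂ, ‖z‖ ≤ 1 → ‖f z‖ ≤ M) (hm : ∀ x : ℝ, |x| < 1 → ‖f x‖ ≤ m) {z : ℂ} (hz : ‖z‖ < 1)
    (hzi : 0 ≤ z.im) : ‖f z‖ ≤ m ^ (1 - tau z) * M ^ tau z := by
  obtain ⟨ζ₀, h0, h1, hζz, hτ⟩ := exists_preimage_strToDisc hz hzi
  -- the transported function on the strip
  set h : ℂ → E := f ∘ strToDisc with hh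
  have hmaps : MapsTo strToDisc (re ⁻¹' Ioo 0 1) (ball 0 1) := fun ζ hζ =>
    mem_ball_zero_iff.2 (norm_strToDisc_lt_one hζ.1.le hζ.2)
  have hmaps' : MapsTo strToDisc (re ⁻¹' Icc 0 1) (closedBall 0 1) := fun ζ hζ =>
    mem_closedBall_zero_iff.2 (norm_strToDisc_le_one hζ.1 hζ.2)
  have hd : DiffContOnCl ℂ h (HadamardThreeLines.verticalStrip 0 1) := by
    refine ⟨?_, ?_⟩
    · exact hf.differentiableOn.comp
        (fun ζ hζ => (differentiableAt_strToDisc hζ.1.le hζ.2.le).differentiableWithinAt) hmaps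
    · have hcl : closure (HadamardThreeLines.verticalStrip 0 1) = re ⁻¹' Icc 0 1 := by
        rw [HadamardThreeLines.verticalStrip, closure_preimage_re, closure_Ioo zero_ne_one]
      rw [hcl]
      have hfc : ContinuousOn f (closedBall 0 1) := by
        have := hf.continuousOn
        rwa [closure_ball (0 : ℂ) one_ne_zero] at this
      exact hfc.comp continuousOn_strToDisc hmaps'
  have hB : BddAbove ((norm ∘ h) '' HadamardThreeLines.verticalClosedStrip 0 1) := by
    refine ⟨M, ?_⟩
    rintro _ ⟨ζ, hζ, rfl⟩
    exact hM _ (norm_strToDisc_le_one hζ.1 hζ.2)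
  have ha : ∀ ζ ∈ re ⁻¹' ({0} : Set ℝ), ‖h ζ‖ ≤ m := by
    intro ζ hζ
    obtain ⟨x, hx, hx'⟩ := strToDisc_of_re_eq_zero (ζ := ζ) hζ
    show ‖f (strToDisc ζ)‖ ≤ m
    rw [hx']
    exact hm x hx
  have hb : ∀ ζ ∈ re ⁻¹' ({1} : Set ℝ), ‖h ζ‖ ≤ M := by
    intro ζ hζ
    have h1' : ζ.re = 1 := hζ
    exact hM _ (norm_strToDisc_le_one (by rw [h1']; exact zero_le_one) h1'.le)
  have hmem : ζ₀ ∈ HadamardThreeLines.verticalClosedStrip 0 1 := ⟨h0, h1.le⟩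
  have key := HadamardThreeLines.norm_le_interp_of_mem_verticalClosedStrip₀₁' h hmem hd hB ha hb
  have : h ζ₀ = f z := by show f (strToDisc ζ₀) = f z; rw [hζz]
  rw [this, hτ] at key
  exact key

/-- **TWO-CONSTANTS THEOREM ON THE DISC, DIAMETER VERSUS CIRCLE** (special case of the Nevanlinna–Ostrowski *n*-constants
theorem ∕ Ransford's two-constants theorem with `D` the half-disc and `B` its diameter, exponent made explicit): `f`
holomorphic in the open unit disc and continuous on the closed disc with values in a complex Banach space, `‖f‖ ≤ M` on the
closed disc, `‖f(x)‖ ≤ m` for real `x ∈ (−1, 1)`; then for `‖z‖ < 1`,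
`‖f(z)‖ ≤ m^{1−τ(z)}·M^{τ(z)}`, `τ(z) = (2/π)·arctan(2|Im z|∕(1−‖z‖²))`. [cite: Ransford1995, Thm. 4.3.7] -/
theorem norm_le_two_constants_disc {f : ℂ → E} {m M : ℝ} (hf : DiffContOnCl ℂ f (ball 0 1))
    (hM : ∀ z : ℂ, ‖z‖ ≤ 1 → ‖f z‖ ≤ M) (hm : ∀ x : ℝ, |x| < 1 → ‖f x‖ ≤ m) {z : ℂ} (hz : ‖z‖ < 1) :
    ‖f z‖ ≤ m ^ (1 - tau z) * M ^ tau z := by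
  rcases le_or_gt 0 z.im with hzi | hzi
  · exact norm_le_two_constants_disc_of_im_nonneg hf hM hm hz hzi
  · -- reflect through the origin: `g ζ = f (−ζ)` has the same bounds and `τ(−z) = τ(z)`
    set g : ℂ → E := f ∘ fun ζ : ℂ => -ζ with hg
    have hmt : MapsTo (fun ζ : ℂ => -ζ) (ball (0 : ℂ) 1) (ball (0 : ℂ) 1) := fun ζ hζ => by
      rw [mem_ball_zero_iff] at hζ ⊢
      rwa [norm_neg]
    have hg' : DiffContOnCl ℂ g (ball 0 1) := hf.comp differentiable_neg.diffContOnCl hmt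
    have hMg : ∀ ζ : ℂ, ‖ζ‖ ≤ 1 → ‖g ζ‖ ≤ M := fun ζ hζ => hM (-ζ) (by simpa using hζ)
    have hmg : ∀ x : ℝ, |x| < 1 → ‖g x‖ ≤ m := fun x hx => by
      show ‖f (-(x : ℂ))‖ ≤ m
      rw [← Complex.ofReal_neg]
      exact hm (-x) (by rwa [abs_neg])
    have hτ : tau (-z) = tau z := by simp [tau]
    have key := norm_le_two_constants_disc_of_im_nonneg hg' hMg hmg (z := -z) (by simpa using hz)
      (by simp; exact hzi.le)
    rw [hτ] at key
    have : g (-z) = f z := by simp [hg]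
    rwa [this] at key

/-- **Uniform form on a smaller disc**: with `m ≤ M`, for `‖z‖ ≤ r < 1`,
`‖f(z)‖ ≤ m^{1−λ}·M^{λ}` with `λ = (2/π)·arctan(2r∕(1−r²)) < 1` — a rate known on the real diameter survives in the interior
with the exponent `1 − λ(r)`. [cite: Ransford1995, Thm. 4.3.7] -/
theorem norm_le_two_constants_disc_of_norm_le {f : ℂ → E} {m M r : ℝ} (hf : DiffContOnCl ℂ f (ball 0 1))
    (hM : ∀ z : ℂ, ‖z‖ ≤ 1 → ‖f z‖ ≤ M) (hm : ∀ x : ℝ, |x| < 1 → ‖f x‖ ≤ m) (hm0 : 0 ≤ m) (hmM : m ≤ M)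
    (hr : r < 1) {z : ℂ} (hz : ‖z‖ ≤ r) :
    ‖f z‖ ≤ m ^ (1 - 2 / π * Real.arctan (2 * r / (1 - r ^ 2))) * M ^ (2 / π * Real.arctan (2 * r / (1 - r ^ 2))) := by
  have hz1 : ‖z‖ < 1 := lt_of_le_of_lt hz hr
  have h := norm_le_two_constants_disc hf hM hm hz1
  have hτ := tau_le_of_norm_le hz hr
  set l := 2 / π * Real.arctan (2 * r / (1 - r ^ 2)) with hl
  have hl1 : l ≤ 1 := by
    have := Real.arctan_lt_pi_div_two (2 * r / (1 - r ^ 2))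
    rw [hl, div_mul_eq_mul_div, div_le_one Real.pi_pos]
    linarith
  have hτ0 := tau_nonneg hz1
  refine h.trans ?_
  -- `t ↦ m^{1−t} M^t` is non-decreasing on `[0,1]` when `0 ≤ m ≤ M`
  rcases hm0.eq_or_lt with hm00 | hmpos
  · -- `m = 0`: the left factor vanishes unless the exponent is zero
    rw [← hm00]
    rcases (sub_nonneg.2 (tau_lt_one z).le).eq_or_lt with h0 | hpos
    · have : tau z = 1 := by linarith
      linarith [tau_lt_one z]
    · rw [Real.zero_rpow hpos.ne', zero_mul]
      exact mul_nonneg (Real.rpow_nonneg le_rfl _) (Real.rpow_nonneg (hm0.trans hmM) _)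
  · have hMpos : 0 < M := lt_of_lt_of_le hmpos hmM
    have key : m ^ (1 - tau z) * M ^ tau z = m * (M / m) ^ tau z := by
      rw [Real.div_rpow hMpos.le hmpos.le, Real.rpow_sub hmpos, Real.rpow_one]
      field_simp
    have key' : m ^ (1 - l) * M ^ l = m * (M / m) ^ l := by
      rw [Real.div_rpow hMpos.le hmpos.le, Real.rpow_sub hmpos, Real.rpow_one]
      field_simp
    rw [key, key']
    refine mul_le_mul_of_nonneg_left ?_ hmpos.le
    exact Real.rpow_le_rpow_of_exponent_le ((one_le_div hmpos).2 hmM) hτ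

end Literature.Analysis.Complex.TwoConstantsDisc

end
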